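import Literature.NumberTheory.GaloisRepresentations.GlobalPFiniteness
import Literature.NumberTheory.Automorphic.POrdinaryHeckeAlgebraGL2
import HarnessLib

/-!
# Chenevier's universal deformation ring of a two-dimensional residual determinant (named fact)

Topic `NumberTheory/GaloisRepresentations`; namespace `Literature.NumberTheory.GaloisRepresentations`.

For a profinite group `G` satisfying Mazur's `Φ_p` (`MazurPhiP`), a finite field `k` of characteristic
`p` and a continuous `2`-dimensional determinant `D̄ : k[G] → k` (the tree's `PseudoRep2 G k`: a trace
`T̄` and a character `d̄` with Chenevier's identity — = determinants of dimension `2`,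
[cite: Chenevier2014, §1.2 Lemma 1.9]; continuity of a determinant = continuity of its characteristic
polynomial coefficients, [cite: Chenevier2014, §2.5]), Chenevier proves that the functor of continuous
deformations of `D̄` to profinite local `W(k)`-algebras with residue field `k` is pro-representable by a
profinite local `W(k)`-algebra `R^u` with universal determinant `D^u`
[cite: Chenevier2014, §3.1 Lemma 3.2 and Prop. 3.3 (= Prop. E of the introduction)], which is NOETHERIAN
when `G` satisfies (F) = `Φ_p` [cite: Chenevier2014, §3.1 Prop. 3.7 and Example (condition (F))].

We record this as ONE named fact `Chenevier2014_universalDeterminantRingTwo` (D-0014, not proved in the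
tree), in the tree's vocabulary and in the form consumers need: TEST OBJECTS are compact Hausdorff local
topological rings `A` with a continuous surjection `π_A : A → k` (a compact Hausdorff ring is profinite —
Kaplansky; Mathlib `Topology/Algebra/Ring/Compact.lean` lists this as a future project — and a profinite
local ring with finite residue field `k` is canonically a `W(k)`-algebra by the functoriality of Witt
vectors / Teichmüller lifts, so this is Chenevier's statement repackaged; uniqueness of the classifying
map and topological generation of `R^u` by the coefficients of `D^u`, [cite: Chenevier2014, Remark 3.5],
are printed too and omitted).
-- TODO(general form): arbitrary dimension `d` (determinants `Γ_ℤ^d`), arbitrary profinite `W(k)`-algebra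
-- coefficients, and the uniqueness clause of pro-representability.

Consumers: route `Langlands/EisensteinGelfandKirillov`, crux `ProModularOfGKBound`, line `two-leaf-fern`,
stub `stub_noetherian` (hosts of the infinite fern are Noetherian).
-/

namespace Literature.NumberTheory.GaloisRepresentations

open Literature.NumberTheory.Automorphic

/-- **Named fact (Chenevier 2014): the universal deformation ring of a continuous `2`-dimensional
determinant over a finite field is a compact Hausdorff local NOETHERIAN ring when the profinite group
satisfies `Φ_p`, universal among continuous deformations to compact Hausdorff local rings.**
For `G` profinite with `MazurPhiP p G`, `k` a finite field of characteristic `p` (discrete) and a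
continuous `D̄ : PseudoRep2 G k`, there are a compact Hausdorff local Noetherian topological ring `R^u`,
a continuous surjection `π^u : R^u → k` and a continuous `D^u : PseudoRep2 G R^u` with `D^u ⊗ π^u = D̄`,
such that every continuous `D_A : PseudoRep2 G A` over a compact Hausdorff local `A` with continuous
surjective `π_A : A → k` and `D_A ⊗ π_A = D̄` is `D^u ⊗ φ` for a continuous ring map `φ : R^u → A`.
Named fact (D-0014). [cite: Chenevier2014, §3.1 Lemma 3.2, Prop. 3.3, Remark 3.5, Prop. 3.7 and Example (condition (F))] -/
def Chenevier2014_universalDeterminantRingTwo : Prop :=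
  ∀ (p : ℕ) [Fact p.Prime] (G : Type) [Group G] [TopologicalSpace G] [IsTopologicalGroup G]
    [CompactSpace G] [T2Space G] [TotallyDisconnectedSpace G], MazurPhiP p G →
    ∀ (k : Type) [Field k] [Finite k] [CharP k p] [TopologicalSpace k] [DiscreteTopology k]
      (Dbar : PseudoRep2 G k), Dbar.IsContinuous →
      ∃ (Ru : Type) (_ : CommRing Ru) (_ : TopologicalSpace Ru) (_ : IsTopologicalRing Ru)
        (_ : CompactSpace Ru) (_ : T2Space Ru) (_ : IsLocalRing Ru) (_ : IsNoetherianRing Ru)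
        (πu : Ru →+* k) (Du : PseudoRep2 G Ru),
        Continuous πu ∧ Function.Surjective πu ∧ Du.IsContinuous ∧ Du.map πu = Dbar ∧
        ∀ (A : Type) [CommRing A] [TopologicalSpace A] [IsTopologicalRing A] [CompactSpace A]
          [T2Space A] [IsLocalRing A] (πA : A →+* k), Continuous πA → Function.Surjective πA →
          ∀ (DA : PseudoRep2 G A), DA.IsContinuous → DA.map πA = Dbar →
            ∃ φ : Ru →+* A, Continuous φ ∧ Du.map φ = DA

end Literature.NumberTheory.GaloisRepresentations
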